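import Summits.Ventures.PercRepro.S1SpreadSlackZeroTwo

/-!
# PercRepro — THE SLACK-ZERO STRUCTURE THEOREM, PART B: THE CASE `s = 3` IS IMPOSSIBLE (p1, gen 36)

`proofs/P1-S2-CORANK6.md` §4u. A `4`-circuit `C = {p₁, p₂, p₃, u}` carrying the private points `p₁, p₂, p₃` of three triangles
`T₁, T₂, T₃` under the budget `3` (`|C ∪ T₁ ∪ T₂ ∪ T₃| ≤ rk + 3`): the chains (`chain_three`, in every order) say that
`T_b ⊆ C ∪ T_a` or `T_c ⊆ C ∪ T_a ∪ T_b`. CASE I, some `T_b ⊆ C ∪ T_a` (**`not_three_private_caseI`**): then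
`T_b = {p_b, u, c}` with `c ∈ T_a`, `u ∉ T_a`, `T_a = {p_a, c, c'}`, and `T_c ∖ C ⊆ {c, c'}` forces `T_c = {p_c, u, c'}` — three
triangles pairwise sharing the distinct points `c, c', u` (`six_of_three_triangles`, regime B). CASE II, no such containment
(**`not_three_private`**): every triangle meets `C` only in its private point and lies in `C ∪` the other two, so `T₃` meets
`T₁` and `T₂` in distinct points and `T₁` meets `T₂` — the same three-cycle. Nothing about any cell is claimed. Axioms: standard.
-/

open scoped Matroid

namespace PercRepro

namespace S1

open Set

variable {α : Type}

/-- **`s = 3`, case I**: some `T_b ⊆ C ∪ T_a` is impossible (labels `a, b, c`; the budget in the order `b, a, c`). -/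
theorem not_three_private_caseI (M : Matroid α) [M.Finite]
    (hC1 : ∀ L ⊆ M.E, M.eRk L = 2 → L.ncard ≤ 3)
    (hno : ¬ ∃ W ⊆ M.E, W.ncard = 6 ∧ M.eRk W ≤ 3)
    {C Ta Tb Tc : Set α} (hC : M.IsCircuit C) (hC4 : C.ncard = 4)
    (hTa : M.IsCircuit Ta) (hTa3 : Ta.ncard = 3) (hTb : M.IsCircuit Tb) (hTb3 : Tb.ncard = 3)
    (hTc : M.IsCircuit Tc) (hTc3 : Tc.ncard = 3) (hab : Ta ≠ Tb) (hac : Ta ≠ Tc) (hbc : Tb ≠ Tc)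
    {pa pb pc u : α} (hpaTa : pa ∈ Ta) (hpaC : pa ∈ C) (hpbC : pb ∈ C) (hpcC : pc ∈ C) (huC : u ∈ C)
    (hpau : pa ≠ u) (hpbu : pb ≠ u) (hpcu : pc ≠ u)
    (hTaC : Ta ∩ C ⊆ {pa, u}) (hTbC : Tb ∩ C ⊆ {pb, u}) (hTcC : Tc ∩ C ⊆ {pc, u})
    (hba : Tb ⊆ C ∪ Ta)
    (hbud : (C ∪ Tb ∪ Ta ∪ Tc).ncard ≤ (M.eRk (C ∪ Tb ∪ Ta ∪ Tc)).toNat + 3) : False := by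
  obtain ⟨c, hTbeq, hcTa, hcC, huTa, huTb⟩ :=
    structure_of_subset_union M hC1 hC hC4 hTb hTb3 hTa hTa3 (Ne.symm hab) hpbC huC hpbu hTbC hba
  -- `Ta ∩ C ⊆ {pa}`, so `Ta` has two points `c, c'` outside `C`
  have hTaC' : Ta ∩ C ⊆ {pa} := by
    intro x hx
    rcases hTaC hx with h | h
    · exact h
    · exact absurd (h ▸ hx.1) huTa
  obtain ⟨x₁, x₂, hx12, hx₁Ta, hx₁C, hx₂Ta, hx₂C⟩ := exists_two_outside M hTa hTa3 hTaC'
  -- the chain in the order `b, a, c`: `Ta ⊄ C ∪ Tb`, so `Tc ⊆ C ∪ Tb ∪ Ta`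
  have hTbC' : ¬ Tb ⊆ C := tri_not_subset_four M hC hC4 hTb hTb3
  have hnotab : ¬ Ta ⊆ C ∪ Tb := not_subset_union_of_two_outside M hC1 hTa hTa3 hTb hTb3 hab hx₁Ta hx₁C hx₂Ta hx₂C hx12
  have hcsub : Tc ⊆ C ∪ Tb ∪ Ta := by
    rcases chain_three M hC hC4 hTb hTbC' hTa hTc hbud with h | h
    · exact absurd h hnotab
    · exact h
  -- `c'` := the point of `Ta ∖ C` other than `c`
  have hTa2 : (Ta \ C).ncard = 2 := ncard_sdiff_eq_two_of_inter M hTa hTa3 hpaTa hpaC hTaC'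
  have hTafin : Ta.Finite := M.ground_finite.subset hTa.subset_ground
  have hc_or : c = x₁ ∨ c = x₂ := by
    by_contra hcon
    push Not at hcon
    have : 3 ≤ (Ta \ C).ncard := by
      have hp : ({c, x₁, x₂} : Set α) ⊆ Ta \ C := by
        intro v hv
        rcases hv with rfl | rfl | rfl
        · exact ⟨hcTa, hcC⟩
        · exact ⟨hx₁Ta, hx₁C⟩
        · exact ⟨hx₂Ta, hx₂C⟩
      have := Set.ncard_le_ncard hp (hTafin.subset sdiff_subset)
      rwa [Set.ncard_insert_of_notMem (by simp only [mem_insert_iff, mem_singleton_iff, not_or]; exact hcon)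
        (toFinite _), Set.ncard_pair hx12] at this
    omega
  -- rename so that `c = x₁`, `c' = x₂`
  obtain ⟨c', hc'Ta, hc'C, hcc'⟩ : ∃ c', c' ∈ Ta ∧ c' ∉ C ∧ c ≠ c' := by
    rcases hc_or with rfl | rfl
    · exact ⟨x₂, hx₂Ta, hx₂C, hx12⟩
    · exact ⟨x₁, hx₁Ta, hx₁C, Ne.symm hx12⟩
  -- `Tc ∖ C ⊆ {c, c'}`; `Tc` lies in `C ∪ Ta` or in `C ∪ Tb`
  have hTc_or : Tc ⊆ C ∪ Ta ∨ Tc ⊆ C ∪ Tb := by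
    by_cases hc'Tc : c' ∈ Tc
    · left
      intro v hv
      by_cases hvC : v ∈ C
      · exact Or.inl hvC
      -- `v ∈ Tb ∪ Ta` outside `C`: `v ∈ Tb ∖ C = {c}` or `v ∈ Ta`
      rcases hcsub hv with (h | h) | h
      · exact absurd h hvC
      · rw [hTbeq] at h
        rcases h with rfl | rfl | rfl
        · exact absurd hpbC hvC
        · exact absurd huC hvC
        · exact Or.inr hcTa
      · exact Or.inr h
    · right
      intro v hv
      by_cases hvC : v ∈ C
      · exact Or.inl hvC
      rcases hcsub hv with (h | h) | h
      · exact absurd h hvC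
      · exact Or.inr h
      · -- `v ∈ Ta ∖ C ⊆ {c, c'}`, and `c' ∉ Tc`, so `v = c ∈ Tb`
        have hvc : v = c := by
          by_contra hvc
          -- `v, c, c'` three points of `Ta` outside `C` unless `v = c'`
          by_cases hvc' : v = c'
          · exact hc'Tc (hvc' ▸ hv)
          have : 3 ≤ (Ta \ C).ncard := by
            have hp : ({v, c, c'} : Set α) ⊆ Ta \ C := by
              intro w hw
              rcases hw with rfl | rfl | rfl
              · exact ⟨h, hvC⟩
              · exact ⟨hcTa, hcC⟩
              · exact ⟨hc'Ta, hc'C⟩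
            have := Set.ncard_le_ncard hp (hTafin.subset sdiff_subset)
            rwa [Set.ncard_insert_of_notMem (by simp only [mem_insert_iff, mem_singleton_iff, not_or]; exact ⟨hvc, hvc'⟩)
              (toFinite _), Set.ncard_pair hcc'] at this
          omega
        rw [hvc, hTbeq]
        exact Or.inr (Or.inr (Or.inr rfl))
  rcases hTc_or with hca | hcb
  · -- `Tc = {pc, u, c''}` with `c'' ∈ Ta ∖ C`; `c'' = c` shares `{u, c}` with `Tb`; so `c'' = c'`: a 3-cycle
    obtain ⟨c'', hTceq, hc''Ta, hc''C, huTa', huTc⟩ :=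
      structure_of_subset_union M hC1 hC hC4 hTc hTc3 hTa hTa3 (Ne.symm hac) hpcC huC hpcu hTcC hca
    have hc''c : c'' ≠ c := by
      intro h
      subst h
      -- `Tb = {pb, u, c''}` and `Tc = {pc, u, c''}` share `u` and `c''`
      have := S2.ncard_inter_le_one_of_triangles M hC1 hTb hTb3 hTc hTc3 hbc
      have hp : ({u, c''} : Set α) ⊆ Tb ∩ Tc := by
        intro v hv
        rcases hv with rfl | rfl
        · exact ⟨huTb, huTc⟩
        · exact ⟨by rw [hTbeq]; exact Or.inr (Or.inr rfl), by rw [hTceq]; exact Or.inr (Or.inr rfl)⟩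
      have h2 := Set.ncard_le_ncard hp ((M.ground_finite.subset hTb.subset_ground).subset inter_subset_left)
      have huc : u ≠ c'' := fun h => hc''C (h ▸ huC)
      rw [Set.ncard_pair huc] at h2
      omega
    -- `c ∈ Tb ∩ Ta`, `c'' ∈ Tc ∩ Ta`, `u ∈ Tb ∩ Tc`
    exact six_of_three_triangles M hC1 hno hTb hTb3 hTc hTc3 hTa hTa3 hbc (Ne.symm hab) (Ne.symm hac)
      (x := c) (y := c'') (by rw [hTbeq]; exact Or.inr (Or.inr rfl)) hcTa
      (by rw [hTceq]; exact Or.inr (Or.inr rfl)) hc''Ta (Ne.symm hc''c)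
      (Set.not_disjoint_iff.2 ⟨u, huTb, huTc⟩)
  · -- `Tc = {pc, u, c''}` with `c'' ∈ Tb ∖ C = {c}`: `Tc` and `Tb` share `u` and `c`
    obtain ⟨c'', hTceq, hc''Tb, hc''C, _, huTc⟩ :=
      structure_of_subset_union M hC1 hC hC4 hTc hTc3 hTb hTb3 (Ne.symm hbc) hpcC huC hpcu hTcC hcb
    have hc''c : c'' = c := by
      rw [hTbeq] at hc''Tb
      rcases hc''Tb with rfl | rfl | rfl
      · exact absurd hpbC hc''C
      · exact absurd huC hc''C
      · rfl
    subst hc''c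
    have := S2.ncard_inter_le_one_of_triangles M hC1 hTb hTb3 hTc hTc3 hbc
    have hp : ({u, c''} : Set α) ⊆ Tb ∩ Tc := by
      intro v hv
      rcases hv with rfl | rfl
      · exact ⟨huTb, huTc⟩
      · exact ⟨by rw [hTbeq]; exact Or.inr (Or.inr rfl), by rw [hTceq]; exact Or.inr (Or.inr rfl)⟩
    have h2 := Set.ncard_le_ncard hp ((M.ground_finite.subset hTb.subset_ground).subset inter_subset_left)
    have huc : u ≠ c'' := fun h => hc''C (h ▸ huC)
    rw [Set.ncard_pair huc] at h2
    omega

/-- If `u ∈ T` besides `p` (both in `C`), the triangle `T` has at most one point outside `C`. -/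
theorem eq_of_two_in_of_sdiff (M : Matroid α) [M.Finite] {C T : Set α} (hT : M.IsCircuit T) (hT3 : T.ncard = 3)
    {p u : α} (hpT : p ∈ T) (hpC : p ∈ C) (huT : u ∈ T) (huC : u ∈ C) (hpu : p ≠ u)
    {v w : α} (hvT : v ∈ T) (hvC : v ∉ C) (hwT : w ∈ T) (hwC : w ∉ C) : v = w := by
  by_contra hvw
  have hTfin : T.Finite := M.ground_finite.subset hT.subset_ground
  have hp : ({p, u, v, w} : Set α) ⊆ T := by
    intro z hz
    rcases hz with rfl | rfl | rfl | rfl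
    · exact hpT
    · exact huT
    · exact hvT
    · exact hwT
  have := Set.ncard_le_ncard hp hTfin
  have hpv : p ≠ v := fun h => hvC (h ▸ hpC)
  have hpw : p ≠ w := fun h => hwC (h ▸ hpC)
  have huv : u ≠ v := fun h => hvC (h ▸ huC)
  have huw : u ≠ w := fun h => hwC (h ▸ huC)
  rw [Set.ncard_insert_of_notMem (by simp only [mem_insert_iff, mem_singleton_iff, not_or]; exact ⟨hpu, hpv, hpw⟩)
    (toFinite _), Set.ncard_insert_of_notMem (by simp only [mem_insert_iff, mem_singleton_iff, not_or]; exact ⟨huv, huw⟩)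
    (toFinite _), Set.ncard_pair hvw] at this
  omega

/-- **`s = 3` is impossible**: a `4`-circuit `C = {p₁, p₂, p₃, u}` cannot carry the private points of three triangles
under the budget `3`. -/
theorem not_three_private (M : Matroid α) [M.Finite]
    (hC1 : ∀ L ⊆ M.E, M.eRk L = 2 → L.ncard ≤ 3)
    (hno : ¬ ∃ W ⊆ M.E, W.ncard = 6 ∧ M.eRk W ≤ 3)
    {C T₁ T₂ T₃ : Set α} (hC : M.IsCircuit C) (hC4 : C.ncard = 4)
    (hT₁ : M.IsCircuit T₁) (hT₁3 : T₁.ncard = 3) (hT₂ : M.IsCircuit T₂) (hT₂3 : T₂.ncard = 3)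
    (hT₃ : M.IsCircuit T₃) (hT₃3 : T₃.ncard = 3) (h12 : T₁ ≠ T₂) (h13 : T₁ ≠ T₃) (h23 : T₂ ≠ T₃)
    {p₁ p₂ p₃ u : α} (hp₁T : p₁ ∈ T₁) (hp₁C : p₁ ∈ C) (hp₂T : p₂ ∈ T₂) (hp₂C : p₂ ∈ C)
    (hp₃T : p₃ ∈ T₃) (hp₃C : p₃ ∈ C) (huC : u ∈ C) (hp₁u : p₁ ≠ u) (hp₂u : p₂ ≠ u) (hp₃u : p₃ ≠ u)
    (hT₁C : T₁ ∩ C ⊆ {p₁, u}) (hT₂C : T₂ ∩ C ⊆ {p₂, u}) (hT₃C : T₃ ∩ C ⊆ {p₃, u})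
    (hbud : (C ∪ T₁ ∪ T₂ ∪ T₃).ncard ≤ (M.eRk (C ∪ T₁ ∪ T₂ ∪ T₃)).toNat + 3) : False := by
  have hbudP : ∀ {X : Set α}, X = C ∪ T₁ ∪ T₂ ∪ T₃ → X.ncard ≤ (M.eRk X).toNat + 3 := fun h => h ▸ hbud
  -- case I in each of the six labellings
  by_cases h21 : T₂ ⊆ C ∪ T₁
  · exact not_three_private_caseI M hC1 hno hC hC4 hT₁ hT₁3 hT₂ hT₂3 hT₃ hT₃3 h12 h13 h23 hp₁T hp₁C hp₂C hp₃C huC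
      hp₁u hp₂u hp₃u hT₁C hT₂C hT₃C h21 (hbudP (by ac_rfl))
  by_cases h31 : T₃ ⊆ C ∪ T₁
  · exact not_three_private_caseI M hC1 hno hC hC4 hT₁ hT₁3 hT₃ hT₃3 hT₂ hT₂3 h13 h12 (Ne.symm h23) hp₁T hp₁C hp₃C hp₂C
      huC hp₁u hp₃u hp₂u hT₁C hT₃C hT₂C h31 (hbudP (by ac_rfl))
  by_cases h12' : T₁ ⊆ C ∪ T₂
  · exact not_three_private_caseI M hC1 hno hC hC4 hT₂ hT₂3 hT₁ hT₁3 hT₃ hT₃3 (Ne.symm h12) h23 h13 hp₂T hp₂C hp₁C hp₃C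
      huC hp₂u hp₁u hp₃u hT₂C hT₁C hT₃C h12' (hbudP (by ac_rfl))
  by_cases h32 : T₃ ⊆ C ∪ T₂
  · exact not_three_private_caseI M hC1 hno hC hC4 hT₂ hT₂3 hT₃ hT₃3 hT₁ hT₁3 h23 (Ne.symm h12) (Ne.symm h13) hp₂T hp₂C
      hp₃C hp₁C huC hp₂u hp₃u hp₁u hT₂C hT₃C hT₁C h32 (hbudP (by ac_rfl))
  by_cases h13' : T₁ ⊆ C ∪ T₃
  · exact not_three_private_caseI M hC1 hno hC hC4 hT₃ hT₃3 hT₁ hT₁3 hT₂ hT₂3 (Ne.symm h13) (Ne.symm h23) h12 hp₃T hp₃C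
      hp₁C hp₂C huC hp₃u hp₁u hp₂u hT₃C hT₁C hT₂C h13' (hbudP (by ac_rfl))
  by_cases h23' : T₂ ⊆ C ∪ T₃
  · exact not_three_private_caseI M hC1 hno hC hC4 hT₃ hT₃3 hT₂ hT₂3 hT₁ hT₁3 (Ne.symm h23) (Ne.symm h13) (Ne.symm h12)
      hp₃T hp₃C hp₂C hp₁C huC hp₃u hp₂u hp₁u hT₃C hT₂C hT₁C h23' (hbudP (by ac_rfl))
  -- case II: every triangle lies in `C ∪` the other two
  have hT₁C' : ¬ T₁ ⊆ C := tri_not_subset_four M hC hC4 hT₁ hT₁3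
  have hT₂C' : ¬ T₂ ⊆ C := tri_not_subset_four M hC hC4 hT₂ hT₂3
  have hc3 : T₃ ⊆ C ∪ T₁ ∪ T₂ := by
    rcases chain_three M hC hC4 hT₁ hT₁C' hT₂ hT₃ hbud with h | h
    · exact absurd h h21
    · exact h
  have hc1 : T₁ ⊆ C ∪ T₂ ∪ T₃ := by
    rcases chain_three M hC hC4 hT₂ hT₂C' hT₃ hT₁ (hbudP (by ac_rfl)) with h | h
    · exact absurd h h32
    · exact h
  -- `u ∉ T₃`: otherwise `T₃ ∖ C` is a single point, inside `T₁` or `T₂`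
  have huT₃ : u ∉ T₃ := by
    intro huT₃
    obtain ⟨c, hcT₃, hcC⟩ : ∃ c ∈ T₃, c ∉ C := by
      by_contra h; push Not at h; exact tri_not_subset_four M hC hC4 hT₃ hT₃3 h
    have honly : ∀ v ∈ T₃, v ∉ C → v = c := fun v hv hvC =>
      eq_of_two_in_of_sdiff M hT₃ hT₃3 hp₃T hp₃C huT₃ huC hp₃u hv hvC hcT₃ hcC
    rcases hc3 hcT₃ with (h | h) | h
    · exact hcC h
    · exact h31 (fun v hv => by
        by_cases hvC : v ∈ C
        · exact Or.inl hvC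
        · rw [honly v hv hvC]; exact Or.inr h)
    · exact h32 (fun v hv => by
        by_cases hvC : v ∈ C
        · exact Or.inl hvC
        · rw [honly v hv hvC]; exact Or.inr h)
  have huT₁ : u ∉ T₁ := by
    intro huT₁
    obtain ⟨c, hcT₁, hcC⟩ : ∃ c ∈ T₁, c ∉ C := by
      by_contra h; push Not at h; exact hT₁C' h
    have honly : ∀ v ∈ T₁, v ∉ C → v = c := fun v hv hvC =>
      eq_of_two_in_of_sdiff M hT₁ hT₁3 hp₁T hp₁C huT₁ huC hp₁u hv hvC hcT₁ hcC
    rcases hc1 hcT₁ with (h | h) | h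
    · exact hcC h
    · exact h12' (fun v hv => by
        by_cases hvC : v ∈ C
        · exact Or.inl hvC
        · rw [honly v hv hvC]; exact Or.inr h)
    · exact h13' (fun v hv => by
        by_cases hvC : v ∈ C
        · exact Or.inl hvC
        · rw [honly v hv hvC]; exact Or.inr h)
  have hT₃C' : T₃ ∩ C ⊆ {p₃} := by
    intro v hv
    rcases hT₃C hv with h | h
    · exact h
    · exact absurd (h ▸ hv.1) huT₃
  have hT₁C'' : T₁ ∩ C ⊆ {p₁} := by
    intro v hv
    rcases hT₁C hv with h | h
    · exact h
    · exact absurd (h ▸ hv.1) huT₁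
  obtain ⟨x, y, hxy, hxT₃, hxC, hyT₃, hyC⟩ := exists_two_outside M hT₃ hT₃3 hT₃C'
  obtain ⟨a, b, hab, haT₁, haC, hbT₁, hbC⟩ := exists_two_outside M hT₁ hT₁3 hT₁C''
  -- `T₁` meets `T₂`: one of `a, b` lies in `T₂` (both in `T₂ ∪ T₃`, not both in `T₃`)
  have hmeet : ¬ Disjoint T₁ T₂ := by
    have ha : a ∈ T₂ ∪ T₃ := by rcases hc1 haT₁ with (h | h) | h; exact absurd h haC; exact Or.inl h; exact Or.inr h
    have hb : b ∈ T₂ ∪ T₃ := by rcases hc1 hbT₁ with (h | h) | h; exact absurd h hbC; exact Or.inl h; exact Or.inr h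
    rcases ha with ha | ha
    · exact Set.not_disjoint_iff.2 ⟨a, haT₁, ha⟩
    rcases hb with hb | hb
    · exact Set.not_disjoint_iff.2 ⟨b, hbT₁, hb⟩
    exfalso
    have := S2.ncard_inter_le_one_of_triangles M hC1 hT₁ hT₁3 hT₃ hT₃3 h13
    have hp : ({a, b} : Set α) ⊆ T₁ ∩ T₃ := by
      intro v hv; rcases hv with rfl | rfl; exact ⟨haT₁, ha⟩; exact ⟨hbT₁, hb⟩
    have h2 := Set.ncard_le_ncard hp ((M.ground_finite.subset hT₁.subset_ground).subset inter_subset_left)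
    rw [Set.ncard_pair hab] at h2
    omega
  -- `x, y ∈ T₁ ∪ T₂`, not both in the same triangle
  have hx : x ∈ T₁ ∪ T₂ := by rcases hc3 hxT₃ with (h | h) | h; exact absurd h hxC; exact Or.inl h; exact Or.inr h
  have hy : y ∈ T₁ ∪ T₂ := by rcases hc3 hyT₃ with (h | h) | h; exact absurd h hyC; exact Or.inl h; exact Or.inr h
  have hT₃fin : T₃.Finite := M.ground_finite.subset hT₃.subset_ground
  have hnot1 : ¬ (x ∈ T₁ ∧ y ∈ T₁) := by
    rintro ⟨hx1, hy1⟩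
    have := S2.ncard_inter_le_one_of_triangles M hC1 hT₃ hT₃3 hT₁ hT₁3 (Ne.symm h13)
    have hp : ({x, y} : Set α) ⊆ T₃ ∩ T₁ := by
      intro v hv; rcases hv with rfl | rfl; exact ⟨hxT₃, hx1⟩; exact ⟨hyT₃, hy1⟩
    have h2 := Set.ncard_le_ncard hp (hT₃fin.subset inter_subset_left)
    rw [Set.ncard_pair hxy] at h2
    omega
  have hnot2 : ¬ (x ∈ T₂ ∧ y ∈ T₂) := by
    rintro ⟨hx2, hy2⟩
    have := S2.ncard_inter_le_one_of_triangles M hC1 hT₃ hT₃3 hT₂ hT₂3 (Ne.symm h23)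
    have hp : ({x, y} : Set α) ⊆ T₃ ∩ T₂ := by
      intro v hv; rcases hv with rfl | rfl; exact ⟨hxT₃, hx2⟩; exact ⟨hyT₃, hy2⟩
    have h2 := Set.ncard_le_ncard hp (hT₃fin.subset inter_subset_left)
    rw [Set.ncard_pair hxy] at h2
    omega
  rcases hx with hx1 | hx2
  · rcases hy with hy1 | hy2
    · exact hnot1 ⟨hx1, hy1⟩
    · exact six_of_three_triangles M hC1 hno hT₁ hT₁3 hT₂ hT₂3 hT₃ hT₃3 h12 h13 h23 hx1 hxT₃ hy2 hyT₃ hxy hmeet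
  · rcases hy with hy1 | hy2
    · exact six_of_three_triangles M hC1 hno hT₂ hT₂3 hT₁ hT₁3 hT₃ hT₃3 (Ne.symm h12) h23 h13 hx2 hxT₃ hy1 hyT₃ hxy
        (fun h => hmeet h.symm)
    · exact hnot2 ⟨hx2, hy2⟩

end S1

end PercRepro
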